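import Summits.QuantumFields.YangMills.Theorems.BlockPlaquetteOneStepLinearisation
import HarnessLib

/-!
# `BlockPlaquetteOneStepLinearisationOfSquareExpansion` — THE COMPOSITION DOOR OF BRICK (M1): ANY FIRST-ORDER EXPANSION OF THE TRANSLATED
# `L×L` SQUARES PASSES THROUGH THE OFFSET-MEAN (one averaging step of [Balaban1987RG1] (0.4) + `exp[mean log]` on `SU(N)`)

Cell `ym3-torus` (YM ladder rung R3 = continuum SU(2) Yang–Mills on T³ — a RUNG, NOT the Clay problem: not d = 4, not infinite volume, not a
mass gap), crux of record `UnitScaleTilt.HistoryTailL` (stmt-QuantumFields-19936), width seat `ym-ust-19936-w2` (gen 14).  Companion of the (M1)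
files ✓`BlockPlaquetteOneStepLinearisationCoupled` ∕ ✓`BlockPlaquetteOneStepLinearisation` ∕ `…Readings` (crux idea «gross-sd-transfer», LINE 28
candidate, stub S_lin; ideator word «w2: GO (M1)» 2026-08-29T16:31:51Z, split «(M1) = the averaging step (w2), (b′) = the Stokes tiling of the
translated squares (px10 g7)»).

WHY.  (M1) says `‖(Ū(∂p′) − 1) − |J|⁻¹ Σ_J (T_J·U(∂(p′)_{x_J})·T_J⁻¹ − 1)‖ ≤ 143·s²` with the translated coarse squares `U(∂(p′)_{x_J}) =
B10Eq47AxialChi.rect U x_J μ ν L L` kept SYMBOLIC (`x_J = walkEnd (emb y) (stairWord σ (off r))`, `T_J = holAt U (walk (emb y) (stairWord σ (off r)))`,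
`J = (r, σ, τ, ρ, ω)`).  The next brick of S_lin — (b′), the first-order non-abelian Stokes expansion of each square into its `L²` transported fine
plaquettes, and later the `j`-fold induction (M3) — produces, for each base point, SOME first-order expression `S(x_J)` with
`‖(U(∂(p′)_{x_J}) − 1) − S(x_J)‖ ≤ ε`.  This file is the glue, stated for an ARBITRARY matrix-valued `S` so that it composes with whatever letters
(b′)∕(M3) export: conjugation by the staircase transporter is an isometry and the offset-mean does not increase norms, hence
  ★★★ `norm_plaqHol_avgFun_sub_one_sub_offsetMean_conj_le_of_squareExpansion`:
    `‖(Ū(∂p′) − 1) − |J|⁻¹ Σ_J T_J·S(x_J)·T_J⁻¹‖ ≤ 143·s² + ε`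
(global letters: all plaquette variables of `U` within `a` of `1`, `s = (((d+4)L)²/4)·a ≤ δ_N/2`; the expansion hypothesis is asked ONLY at the
`|(Fin d → Fin L) × Perm (Fin d)|` base points `x(r, σ)` that occur), together with the two letters it is made of:
★ `offsetMean_transportedSquare_sub_offsetMean_conj_eq` (the difference of the two means IS the mean of the conjugated expansion errors — an identity)
and ★ `norm_offsetMean_conj_le` (a mean of `SU(N)`-conjugates of matrices of norm `≤ ε` has norm `≤ ε`).
Print: [Balaban1985Averaging] (47)–(49) p. 25–26 — (47)–(48) is (M1), (49) `|V₀(∂p) − 1 − iA(∂p)| < ½(|A|(∂p))²` is the per-square expansion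
whose error passes through the block mean additively, exactly as here.

WHAT THIS FILE PROVES (kernel; 0 `def`, 0 `sorry`; same namespace as the (M1) files).  §1 private `SU(N)` ∕ mean letters; §2 the identity, the
mean-of-conjugates bound, and the door (★★★), plus its `dist₁` reading ★ `abs_dist1_plaqHol_avgFun_sub_norm_offsetMean_conj_le_of_squareExpansion`.

HONEST FRAMING.  Deterministic lattice bookkeeping on the tree's own objects (`--supports stmt-QuantumFields-19936`); a door with an explicit
expansion hypothesis `hS` (discharged by (b′) when it lands — not a named fact, not a crux restatement); proves no stub, crux, rung or summit
statement; S_lin ∕ S_dom ∕ «ShallowFluxSecondMomentL» ∕ (Q) ∕ K1 ∕ `MeanDeviationL` ∕ `HistoryTailL` are NOT proved; the Yang–Mills mass gap is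
NOT proved.

References: [Balaban1985Averaging] T. Bałaban, CMP 98 (1985) 17–51, (47)–(49) pp. 25–26; [Balaban1987RG1] T. Bałaban, CMP 109 (1987) 249–301,
(0.3)–(0.4) pp. 252–253.
-/

noncomputable section

open scoped BigOperators

namespace Summit.QuantumFields.YangMills.Theorems.BlockPlaquetteOneStepLinearisation

open Literature.MathematicalPhysics.QuantumFieldTheory.Balaban1983to89
open Literature.MathematicalPhysics.QuantumFieldTheory.Balaban1983to89.BlockAveragingEMLProp2

/-! ## §1 Private letters -/

section Letters

open scoped Matrix.Norms.L2Operator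

variable {n : Type*} [Fintype n] [DecidableEq n]

/-- Elements of `SU(N)` are unitary matrices. [folklore] -/
private theorem coe_mem_unitaryGroup (g : Matrix.specialUnitaryGroup n ℂ) : (g : Matrix n n ℂ) ∈ Matrix.unitaryGroup n ℂ :=
  (Matrix.mem_specialUnitaryGroup_iff.1 g.2).1

/-- `g · g* = 1` for `g ∈ SU(N)`. [folklore] -/
private theorem coe_mul_star_self (g : Matrix.specialUnitaryGroup n ℂ) : (g : Matrix n n ℂ) * star (g : Matrix n n ℂ) = 1 :=
  Unitary.mul_star_self_of_mem (coe_mem_unitaryGroup g)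

/-- The inverse in `SU(N)` is the conjugate transpose (coercion lemma). [folklore] -/
private theorem coe_inv_eq_star (g : Matrix.specialUnitaryGroup n ℂ) :
    ((g⁻¹ : Matrix.specialUnitaryGroup n ℂ) : Matrix n n ℂ) = star (g : Matrix n n ℂ) := rfl

/-- Unitary conjugation preserves the operator norm: `‖g X g*‖ = ‖X‖`. [folklore] -/
private theorem norm_conj_eq (g : Matrix.specialUnitaryGroup n ℂ) (X : Matrix n n ℂ) :
    ‖(g : Matrix n n ℂ) * X * star (g : Matrix n n ℂ)‖ = ‖X‖ := by
  rw [← coe_inv_eq_star, CStarRing.norm_mul_mem_unitary _ (coe_mem_unitaryGroup g⁻¹),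
    CStarRing.norm_mem_unitary_mul _ (coe_mem_unitaryGroup g)]

/-- `uXw − 1 = u(X − 1)w` when `uw = 1`. [folklore] -/
private theorem conj_sub_one {u w X : Matrix n n ℂ} (h : u * w = 1) : u * X * w - 1 = u * (X - 1) * w := by
  rw [mul_sub, sub_mul, mul_one, h]

variable {ι : Type*} [Fintype ι]

/-- The mean of a family bounded by `B` in norm has norm `≤ B`. [folklore] -/
private theorem norm_mean_le [Nonempty ι] {m : ι → Matrix n n ℂ} {B : ℝ} (h : ∀ i, ‖m i‖ ≤ B) :
    ‖((Fintype.card ι : ℂ))⁻¹ • ∑ i, m i‖ ≤ B := by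
  have hc : (0 : ℝ) < Fintype.card ι := Nat.cast_pos.mpr Fintype.card_pos
  have hsum : ∑ i, ‖m i‖ ≤ ∑ _i : ι, B := Finset.sum_le_sum fun i _ => h i
  rw [Finset.sum_const, Finset.card_univ, nsmul_eq_mul] at hsum
  rw [norm_smul, norm_inv, Complex.norm_natCast, inv_mul_le_iff₀ hc]
  exact (norm_sum_le _ _).trans hsum

end Letters

/-! ## §2 The composition door: an expansion of the translated squares passes through the offset-mean -/

section Door

open T4Continuum BlockAveraging AveragingRT ExpMeanLog LatticeWordStokes B10Eq47AxialChi NormedSpace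
open scoped Matrix.Norms.L2Operator

variable {n : Type*} [Fintype n] [DecidableEq n] [Nonempty n] {P : Params} {j : ℕ}

/-- **THE DIFFERENCE OF THE TWO OFFSET-MEANS IS THE MEAN OF THE CONJUGATED EXPANSION ERRORS** (identity): for any `S : Site P j → M_N(ℂ)`,
`|J|⁻¹Σ_J (T_J·U(∂(p′)_{x_J})·T_J⁻¹ − 1) − |J|⁻¹Σ_J T_J·S(x_J)·T_J* = |J|⁻¹Σ_J T_J·((U(∂(p′)_{x_J}) − 1) − S(x_J))·T_J*`. [cite: Balaban1985Averaging, (47)-(49) pp.25-26 (bookkeeping)] -/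
theorem offsetMean_transportedSquare_sub_offsetMean_conj_eq (U : GaugeField P j (Matrix.specialUnitaryGroup n ℂ))
    (S : Site P j → Matrix n n ℂ) (y : Site P (j + 1)) (μ ν : Fin P.d) :
    ((Fintype.card ((Fin P.d → Fin P.L) × Equiv.Perm (Fin P.d) × Equiv.Perm (Fin P.d) × Equiv.Perm (Fin P.d) ×
          Equiv.Perm (Fin P.d)) : ℂ))⁻¹ • ∑ J : (Fin P.d → Fin P.L) × Equiv.Perm (Fin P.d) × Equiv.Perm (Fin P.d) ×
          Equiv.Perm (Fin P.d) × Equiv.Perm (Fin P.d),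
          ((((holAt U (walk (emb y) (stairWord J.2.1 (off J.1))) * rect U (walkEnd (emb y) (stairWord J.2.1 (off J.1))) μ ν P.L P.L *
            (holAt U (walk (emb y) (stairWord J.2.1 (off J.1))))⁻¹ : Matrix.specialUnitaryGroup n ℂ)) : Matrix n n ℂ) - 1) -
      ((Fintype.card ((Fin P.d → Fin P.L) × Equiv.Perm (Fin P.d) × Equiv.Perm (Fin P.d) × Equiv.Perm (Fin P.d) ×
          Equiv.Perm (Fin P.d)) : ℂ))⁻¹ • ∑ J : (Fin P.d → Fin P.L) × Equiv.Perm (Fin P.d) × Equiv.Perm (Fin P.d) ×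
          Equiv.Perm (Fin P.d) × Equiv.Perm (Fin P.d),
          ((holAt U (walk (emb y) (stairWord J.2.1 (off J.1))) : Matrix.specialUnitaryGroup n ℂ) : Matrix n n ℂ) *
            S (walkEnd (emb y) (stairWord J.2.1 (off J.1))) *
            star ((holAt U (walk (emb y) (stairWord J.2.1 (off J.1))) : Matrix.specialUnitaryGroup n ℂ) : Matrix n n ℂ) =
      ((Fintype.card ((Fin P.d → Fin P.L) × Equiv.Perm (Fin P.d) × Equiv.Perm (Fin P.d) × Equiv.Perm (Fin P.d) ×
          Equiv.Perm (Fin P.d)) : ℂ))⁻¹ • ∑ J : (Fin P.d → Fin P.L) × Equiv.Perm (Fin P.d) × Equiv.Perm (Fin P.d) ×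
          Equiv.Perm (Fin P.d) × Equiv.Perm (Fin P.d),
          ((holAt U (walk (emb y) (stairWord J.2.1 (off J.1))) : Matrix.specialUnitaryGroup n ℂ) : Matrix n n ℂ) *
            ((((rect U (walkEnd (emb y) (stairWord J.2.1 (off J.1))) μ ν P.L P.L : Matrix.specialUnitaryGroup n ℂ) : Matrix n n ℂ) - 1) -
              S (walkEnd (emb y) (stairWord J.2.1 (off J.1)))) *
            star ((holAt U (walk (emb y) (stairWord J.2.1 (off J.1))) : Matrix.specialUnitaryGroup n ℂ) : Matrix n n ℂ) := by
  rw [← smul_sub, ← Finset.sum_sub_distrib]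
  congr 1
  refine Finset.sum_congr rfl fun J _ => ?_
  simp only [Submonoid.coe_mul, coe_inv_eq_star]
  rw [conj_sub_one (coe_mul_star_self _)]
  simp only [mul_sub, sub_mul]

omit [Nonempty n] in
/-- **A MEAN OF `SU(N)`-CONJUGATES OF SMALL MATRICES IS SMALL**: if `‖E_J‖ ≤ ε` for every index, then `‖|J|⁻¹Σ_J T_J·E_J·T_J*‖ ≤ ε`
(unitary invariance of the operator norm + the triangle inequality). [folklore] -/
theorem norm_offsetMean_conj_le {ι : Type*} [Fintype ι] [Nonempty ι] (T : ι → Matrix.specialUnitaryGroup n ℂ) (E : ι → Matrix n n ℂ)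
    {ε : ℝ} (hE : ∀ i, ‖E i‖ ≤ ε) :
    ‖((Fintype.card ι : ℂ))⁻¹ • ∑ i, ((T i : Matrix.specialUnitaryGroup n ℂ) : Matrix n n ℂ) * E i *
        star ((T i : Matrix.specialUnitaryGroup n ℂ) : Matrix n n ℂ)‖ ≤ ε :=
  norm_mean_le fun i => by rw [norm_conj_eq]; exact hE i

/-- **THE COMPOSITION DOOR OF (M1): ANY FIRST-ORDER EXPANSION OF THE TRANSLATED SQUARES PASSES THROUGH THE OFFSET-MEAN.**  Let every plaquette
variable of `U : GaugeField P j SU(N)` be within `a` of `1` and `s = (((d+4)L)²/4)·a ≤ δ_N/2`; let `p′ = ⟨y; μ < ν⟩` be a coarse plaquette and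
`S : Site P j → M_N(ℂ)` ANY assignment with `‖(U(∂(p′)_x) − 1) − S(x)‖ ≤ ε` at the base points `x = x(r, σ) = walkEnd (emb y) (stairWord σ (off r))`
(`U(∂(p′)_x) = rect U x μ ν L L`; e.g. `S(x)` = the transported Stokes sum of the `L²` fine plaquettes of the square — brick (b′) — or, after the
`j`-fold induction (M3), the multi-transport linear flux functional).  Then
  `‖(Ū(∂p′) − 1) − |J|⁻¹ Σ_J T_J·S(x_J)·T_J⁻¹‖ ≤ 143·s² + ε`,  `T_J = holAt U (walk (emb y) (stairWord σ (off r)))`, `J = (r, σ, τ, ρ, ω)`: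
the coarse plaquette deviation of the averaged field is the offset-mean of the TRANSPORTED EXPANSIONS, the expansion error entering additively
(print's (47)–(49): the per-square error `½(|A|(∂p))²` passes through the block mean). [cite: Balaban1985Averaging, (47)-(49) pp.25-26; Balaban1987RG1, (0.3)-(0.4) pp.252-253] -/
theorem norm_plaqHol_avgFun_sub_one_sub_offsetMean_conj_le_of_squareExpansion {a ε : ℝ} (ha : 0 ≤ a)
    {U : GaugeField P j (Matrix.specialUnitaryGroup n ℂ)} (hU : ∀ q : Plaq P j, dist1 (GaugeField.plaqHol U q) ≤ a)
    (hs : ((((P.d + 4) * P.L : ℕ) : ℝ) ^ 2 / 4) * a ≤ deltaSU n / 2) (y : Site P (j + 1)) {μ ν : Fin P.d} (hμν : μ < ν)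
    (S : Site P j → Matrix n n ℂ)
    (hS : ∀ (r : Fin P.d → Fin P.L) (σ : Equiv.Perm (Fin P.d)),
      ‖((((rect U (walkEnd (emb y) (stairWord σ (off r))) μ ν P.L P.L : Matrix.specialUnitaryGroup n ℂ)) : Matrix n n ℂ) - 1) -
        S (walkEnd (emb y) (stairWord σ (off r)))‖ ≤ ε) :
    ‖(((GaugeField.plaqHol (avgFun (expMeanLogSU (n := n)) U) ⟨y, μ, ν, hμν⟩ : Matrix.specialUnitaryGroup n ℂ) : Matrix n n ℂ) - 1) -
        ((Fintype.card ((Fin P.d → Fin P.L) × Equiv.Perm (Fin P.d) × Equiv.Perm (Fin P.d) × Equiv.Perm (Fin P.d) ×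
          Equiv.Perm (Fin P.d)) : ℂ))⁻¹ • ∑ J : (Fin P.d → Fin P.L) × Equiv.Perm (Fin P.d) × Equiv.Perm (Fin P.d) ×
          Equiv.Perm (Fin P.d) × Equiv.Perm (Fin P.d),
          ((holAt U (walk (emb y) (stairWord J.2.1 (off J.1))) : Matrix.specialUnitaryGroup n ℂ) : Matrix n n ℂ) *
            S (walkEnd (emb y) (stairWord J.2.1 (off J.1))) *
            star ((holAt U (walk (emb y) (stairWord J.2.1 (off J.1))) : Matrix.specialUnitaryGroup n ℂ) : Matrix n n ℂ)‖ ≤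
      143 * (((((P.d + 4) * P.L : ℕ) : ℝ) ^ 2 / 4) * a) ^ 2 + ε := by
  haveI : Nonempty (Fin P.d → Fin P.L) := ⟨fun _ => ⟨0, P.L_pos⟩⟩
  have h1 := norm_plaqHol_avgFun_sub_one_sub_offsetMean_le ha hU hs y hμν
  have h2 : ‖((Fintype.card ((Fin P.d → Fin P.L) × Equiv.Perm (Fin P.d) × Equiv.Perm (Fin P.d) × Equiv.Perm (Fin P.d) ×
          Equiv.Perm (Fin P.d)) : ℂ))⁻¹ • ∑ J : (Fin P.d → Fin P.L) × Equiv.Perm (Fin P.d) × Equiv.Perm (Fin P.d) ×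
          Equiv.Perm (Fin P.d) × Equiv.Perm (Fin P.d),
          ((((holAt U (walk (emb y) (stairWord J.2.1 (off J.1))) * rect U (walkEnd (emb y) (stairWord J.2.1 (off J.1))) μ ν P.L P.L *
            (holAt U (walk (emb y) (stairWord J.2.1 (off J.1))))⁻¹ : Matrix.specialUnitaryGroup n ℂ)) : Matrix n n ℂ) - 1) -
      ((Fintype.card ((Fin P.d → Fin P.L) × Equiv.Perm (Fin P.d) × Equiv.Perm (Fin P.d) × Equiv.Perm (Fin P.d) ×
          Equiv.Perm (Fin P.d)) : ℂ))⁻¹ • ∑ J : (Fin P.d → Fin P.L) × Equiv.Perm (Fin P.d) × Equiv.Perm (Fin P.d) ×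
          Equiv.Perm (Fin P.d) × Equiv.Perm (Fin P.d),
          ((holAt U (walk (emb y) (stairWord J.2.1 (off J.1))) : Matrix.specialUnitaryGroup n ℂ) : Matrix n n ℂ) *
            S (walkEnd (emb y) (stairWord J.2.1 (off J.1))) *
            star ((holAt U (walk (emb y) (stairWord J.2.1 (off J.1))) : Matrix.specialUnitaryGroup n ℂ) : Matrix n n ℂ)‖ ≤ ε := by
    rw [offsetMean_transportedSquare_sub_offsetMean_conj_eq U S y μ ν]
    exact norm_offsetMean_conj_le
      (fun J : (Fin P.d → Fin P.L) × Equiv.Perm (Fin P.d) × Equiv.Perm (Fin P.d) × Equiv.Perm (Fin P.d) × Equiv.Perm (Fin P.d) =>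
        holAt U (walk (emb y) (stairWord J.2.1 (off J.1))))
      (fun J => ((((rect U (walkEnd (emb y) (stairWord J.2.1 (off J.1))) μ ν P.L P.L : Matrix.specialUnitaryGroup n ℂ)) :
        Matrix n n ℂ) - 1) - S (walkEnd (emb y) (stairWord J.2.1 (off J.1))))
      fun J => hS J.1 J.2.1
  have key := norm_sub_le_norm_sub_add_norm_sub
    ((((GaugeField.plaqHol (avgFun (expMeanLogSU (n := n)) U) ⟨y, μ, ν, hμν⟩ : Matrix.specialUnitaryGroup n ℂ) : Matrix n n ℂ) - 1))
    (((Fintype.card ((Fin P.d → Fin P.L) × Equiv.Perm (Fin P.d) × Equiv.Perm (Fin P.d) × Equiv.Perm (Fin P.d) ×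
          Equiv.Perm (Fin P.d)) : ℂ))⁻¹ • ∑ J : (Fin P.d → Fin P.L) × Equiv.Perm (Fin P.d) × Equiv.Perm (Fin P.d) ×
          Equiv.Perm (Fin P.d) × Equiv.Perm (Fin P.d),
          ((((holAt U (walk (emb y) (stairWord J.2.1 (off J.1))) * rect U (walkEnd (emb y) (stairWord J.2.1 (off J.1))) μ ν P.L P.L *
            (holAt U (walk (emb y) (stairWord J.2.1 (off J.1))))⁻¹ : Matrix.specialUnitaryGroup n ℂ)) : Matrix n n ℂ) - 1))
    (((Fintype.card ((Fin P.d → Fin P.L) × Equiv.Perm (Fin P.d) × Equiv.Perm (Fin P.d) × Equiv.Perm (Fin P.d) ×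
          Equiv.Perm (Fin P.d)) : ℂ))⁻¹ • ∑ J : (Fin P.d → Fin P.L) × Equiv.Perm (Fin P.d) × Equiv.Perm (Fin P.d) ×
          Equiv.Perm (Fin P.d) × Equiv.Perm (Fin P.d),
          ((holAt U (walk (emb y) (stairWord J.2.1 (off J.1))) : Matrix.specialUnitaryGroup n ℂ) : Matrix n n ℂ) *
            S (walkEnd (emb y) (stairWord J.2.1 (off J.1))) *
            star ((holAt U (walk (emb y) (stairWord J.2.1 (off J.1))) : Matrix.specialUnitaryGroup n ℂ) : Matrix n n ℂ))
  linarith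

/-- **THE `dist₁` READING OF THE DOOR**: `|dist₁(Ū(∂p′)) − ‖|J|⁻¹ Σ_J T_J·S(x_J)·T_J⁻¹‖| ≤ 143·s² + ε` — the coarse plaquette deviation of the
averaged field IS the norm of the offset-mean of the transported expansions, up to second order plus the expansion error. [cite: Balaban1985Averaging, (47)-(49) pp.25-26] -/
theorem abs_dist1_plaqHol_avgFun_sub_norm_offsetMean_conj_le_of_squareExpansion {a ε : ℝ} (ha : 0 ≤ a)
    {U : GaugeField P j (Matrix.specialUnitaryGroup n ℂ)} (hU : ∀ q : Plaq P j, dist1 (GaugeField.plaqHol U q) ≤ a)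
    (hs : ((((P.d + 4) * P.L : ℕ) : ℝ) ^ 2 / 4) * a ≤ deltaSU n / 2) (y : Site P (j + 1)) {μ ν : Fin P.d} (hμν : μ < ν)
    (S : Site P j → Matrix n n ℂ)
    (hS : ∀ (r : Fin P.d → Fin P.L) (σ : Equiv.Perm (Fin P.d)),
      ‖((((rect U (walkEnd (emb y) (stairWord σ (off r))) μ ν P.L P.L : Matrix.specialUnitaryGroup n ℂ)) : Matrix n n ℂ) - 1) -
        S (walkEnd (emb y) (stairWord σ (off r)))‖ ≤ ε) :
    |dist1 (GaugeField.plaqHol (avgFun (expMeanLogSU (n := n)) U) ⟨y, μ, ν, hμν⟩) -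
        ‖((Fintype.card ((Fin P.d → Fin P.L) × Equiv.Perm (Fin P.d) × Equiv.Perm (Fin P.d) × Equiv.Perm (Fin P.d) ×
          Equiv.Perm (Fin P.d)) : ℂ))⁻¹ • ∑ J : (Fin P.d → Fin P.L) × Equiv.Perm (Fin P.d) × Equiv.Perm (Fin P.d) ×
          Equiv.Perm (Fin P.d) × Equiv.Perm (Fin P.d),
          ((holAt U (walk (emb y) (stairWord J.2.1 (off J.1))) : Matrix.specialUnitaryGroup n ℂ) : Matrix n n ℂ) *
            S (walkEnd (emb y) (stairWord J.2.1 (off J.1))) *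
            star ((holAt U (walk (emb y) (stairWord J.2.1 (off J.1))) : Matrix.specialUnitaryGroup n ℂ) : Matrix n n ℂ)‖| ≤
      143 * (((((P.d + 4) * P.L : ℕ) : ℝ) ^ 2 / 4) * a) ^ 2 + ε := by
  rw [FederbushMean.dist1_SU_eq]
  exact (abs_norm_sub_norm_le _ _).trans
    (norm_plaqHol_avgFun_sub_one_sub_offsetMean_conj_le_of_squareExpansion ha hU hs y hμν S hS)

end Door

end Summit.QuantumFields.YangMills.Theorems.BlockPlaquetteOneStepLinearisation

end
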